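import Summits.AnomalousDissipation.AnomalousDissipation.Theorems.SolenoidalFractalHomogenisationLagrangianStepCellInputsBilinear
import Literature.Analysis.FluidPDE.DivFreeProjectionFourier
import Literature.Analysis.FluidPDE.PassiveVectorTensorPropagatorUnique
import HarnessLib

/-!
# K1L_D (stmt-AnomalousDissipation-27980), line «onelevel-design»: the bilinear window-error bound (BIL) of split v31 §9z only has to be
# proved on weakly DIVERGENCE-FREE data and tests (helper; `--supports … --as helper`; lead-k1l-onelevel-p1 g4)

§9z `cellInputs_bilinear_text` (`Cruxes/LagrangianRenormalisationStep/Lines/onelevel_S23_split.lean` v31) asks, for the window error of two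
`Torus.IsPropagator` families `U = Um1 (jr) s'`, `T = Um (jr) s'`, the bound `|⟪U x − T x, y⟫| ≤ η · N(x) · N(y)` for ALL `x, y ∈ V2`, with
`N(v)² = Σ_{k∈S} w_k ‖𝓕v(k)‖² + (‖v‖² − Σ_{k∈S} ‖𝓕v(k)‖²)`.  Its analytic producers (memo L7/L8: the propagator duality `…WindowDuality`
needs divergence-free data) naturally deliver it for divergence-free `x, y` only.  THIS FILE closes the gap once and for all:
* `rest_eq_tsum_indicator` — `‖v‖² − Σ_S ‖𝓕v(k)‖² = Σ'_k 𝟙[k ∉ S] ‖𝓕v(k)‖²` (Parseval);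
* `nsq_le_of_fcoeff_le` — `N` is monotone under modewise domination `‖𝓕v(k)‖ ≤ ‖𝓕x(k)‖` (weights `w ≥ 0`);
* `nsq_starProjection_le` — the divergence-free projection `P_σ` is a modewise contraction (`DivFreeProjectionFourier`), so `N(P_σ x) ≤ N(x)`;
* **`bilinear_of_divFree`** — for `U, T` that only see `P_σ` of their argument and have divergence-free range, (BIL) on `divFreeL2` ⇒ (BIL) on `V2`;
* **`bilinear_of_divFree_propagator`** — the same for two `Torus.IsPropagator` window maps (`apply_eq_apply_starProjection`, `divFree`).
NOT a proof of §9z, of the crux, or of AD; rung F-D1.A0.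
-/

set_option linter.dupNamespace false  -- the summit-side namespace `Summit.AnomalousDissipation.AnomalousDissipation.…` repeats a component by design (D-0017)

noncomputable section

namespace Summit.AnomalousDissipation.AnomalousDissipation.Theorems.SolenoidalFractalHomogenisation.LagrangianStep

open Literature.Analysis Literature.Analysis.FunctionSpaces Literature.Analysis.FluidPDE
open MeasureTheory Set Filter UnitAddTorus
open scoped ENNReal NNReal InnerProductSpace Classical
open OneLevelSplit

/-! ## `N` is monotone under modewise domination -/

/-- `‖v‖² − Σ_S ‖𝓕v(k)‖² = Σ'_k (if k ∈ S then 0 else ‖𝓕v(k)‖²)` on `V2`. -/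
theorem rest_eq_tsum_indicator (S : Finset (Fin 3 → ℤ)) (v : V2) :
    ‖v‖ ^ 2 - ∑ k ∈ S, ‖mFourierCoeff (EuclideanSpace.complexify ∘ ⇑v) k‖ ^ 2
      = ∑' k : Fin 3 → ℤ, (if k ∈ S then 0 else ‖mFourierCoeff (EuclideanSpace.complexify ∘ ⇑v) k‖ ^ 2) := by
  have h1 := hasSum_norm_sq_fcoeff v
  have h2 : HasSum (fun k : Fin 3 → ℤ => if k ∈ S then ‖mFourierCoeff (EuclideanSpace.complexify ∘ ⇑v) k‖ ^ 2 else 0)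
      (∑ k ∈ S, ‖mFourierCoeff (EuclideanSpace.complexify ∘ ⇑v) k‖ ^ 2) := by
    have h : HasSum (fun k : Fin 3 → ℤ => if k ∈ S then ‖mFourierCoeff (EuclideanSpace.complexify ∘ ⇑v) k‖ ^ 2 else 0)
        (∑ k ∈ S, (if k ∈ S then ‖mFourierCoeff (EuclideanSpace.complexify ∘ ⇑v) k‖ ^ 2 else 0)) :=
      hasSum_sum_of_ne_finset_zero (fun k hk => by simp [hk])
    have e : ∑ k ∈ S, (if k ∈ S then ‖mFourierCoeff (EuclideanSpace.complexify ∘ ⇑v) k‖ ^ 2 else 0)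
        = ∑ k ∈ S, ‖mFourierCoeff (EuclideanSpace.complexify ∘ ⇑v) k‖ ^ 2 := Finset.sum_congr rfl fun k hk => if_pos hk
    rw [e] at h
    exact h
  have h3 : HasSum (fun k : Fin 3 → ℤ => if k ∈ S then 0 else ‖mFourierCoeff (EuclideanSpace.complexify ∘ ⇑v) k‖ ^ 2)
      (‖v‖ ^ 2 - ∑ k ∈ S, ‖mFourierCoeff (EuclideanSpace.complexify ∘ ⇑v) k‖ ^ 2) := by
    have h := h1.sub h2
    refine h.congr_fun fun k => ?_
    by_cases hk : k ∈ S <;> simp [hk]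
  exact h3.tsum_eq.symm

/-- **Monotonicity of `N²`**: modewise domination `‖𝓕v(k)‖ ≤ ‖𝓕x(k)‖` and weights `w ≥ 0` give `N(v)² ≤ N(x)²`. -/
theorem nsq_le_of_fcoeff_le (S : Finset (Fin 3 → ℤ)) (w : (Fin 3 → ℤ) → ℝ) (hw0 : ∀ k, 0 ≤ w k) {v x : V2}
    (h : ∀ k, ‖mFourierCoeff (EuclideanSpace.complexify ∘ ⇑v) k‖ ≤ ‖mFourierCoeff (EuclideanSpace.complexify ∘ ⇑x) k‖) :
    ∑ k ∈ S, w k * ‖mFourierCoeff (EuclideanSpace.complexify ∘ ⇑v) k‖ ^ 2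
        + (‖v‖ ^ 2 - ∑ k ∈ S, ‖mFourierCoeff (EuclideanSpace.complexify ∘ ⇑v) k‖ ^ 2)
      ≤ ∑ k ∈ S, w k * ‖mFourierCoeff (EuclideanSpace.complexify ∘ ⇑x) k‖ ^ 2
        + (‖x‖ ^ 2 - ∑ k ∈ S, ‖mFourierCoeff (EuclideanSpace.complexify ∘ ⇑x) k‖ ^ 2) := by
  have hsq : ∀ k, ‖mFourierCoeff (EuclideanSpace.complexify ∘ ⇑v) k‖ ^ 2 ≤ ‖mFourierCoeff (EuclideanSpace.complexify ∘ ⇑x) k‖ ^ 2 :=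
    fun k => pow_le_pow_left₀ (norm_nonneg _) (h k) 2
  refine add_le_add (Finset.sum_le_sum fun k _ => mul_le_mul_of_nonneg_left (hsq k) (hw0 k)) ?_
  rw [rest_eq_tsum_indicator, rest_eq_tsum_indicator]
  have hsv : Summable (fun k : Fin 3 → ℤ => if k ∈ S then 0 else ‖mFourierCoeff (EuclideanSpace.complexify ∘ ⇑v) k‖ ^ 2) :=
    Summable.of_nonneg_of_le (fun k => by split_ifs <;> positivity) (fun k => by split_ifs <;> simp)
      (hasSum_norm_sq_fcoeff v).summable
  have hsx : Summable (fun k : Fin 3 → ℤ => if k ∈ S then 0 else ‖mFourierCoeff (EuclideanSpace.complexify ∘ ⇑x) k‖ ^ 2) :=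
    Summable.of_nonneg_of_le (fun k => by split_ifs <;> positivity) (fun k => by split_ifs <;> simp)
      (hasSum_norm_sq_fcoeff x).summable
  exact Summable.tsum_le_tsum (fun k => by split_ifs <;> simp [hsq k]) hsv hsx

/-- **The divergence-free projection does not increase `N`**: `N(P_σ x)² ≤ N(x)²` (`P_σ` is a modewise contraction). -/
theorem nsq_starProjection_le (S : Finset (Fin 3 → ℤ)) (w : (Fin 3 → ℤ) → ℝ) (hw0 : ∀ k, 0 ≤ w k) (x : V2) :
    ∑ k ∈ S, w k * ‖mFourierCoeff (EuclideanSpace.complexify ∘ ⇑((Torus.divFreeL2 (Fin 3)).starProjection x)) k‖ ^ 2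
        + (‖(Torus.divFreeL2 (Fin 3)).starProjection x‖ ^ 2
          - ∑ k ∈ S, ‖mFourierCoeff (EuclideanSpace.complexify ∘ ⇑((Torus.divFreeL2 (Fin 3)).starProjection x)) k‖ ^ 2)
      ≤ ∑ k ∈ S, w k * ‖mFourierCoeff (EuclideanSpace.complexify ∘ ⇑x) k‖ ^ 2
        + (‖x‖ ^ 2 - ∑ k ∈ S, ‖mFourierCoeff (EuclideanSpace.complexify ∘ ⇑x) k‖ ^ 2) :=
  nsq_le_of_fcoeff_le S w hw0 fun k => Torus.norm_mFourierCoeff_starProjection_le x k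

/-! ## (BIL) on divergence-free data suffices -/

/-- **(BIL) on `divFreeL2` ⇒ (BIL) on `V2`.**  Let `U, T : V2 →L[ℝ] V2` see only the divergence-free projection of their argument
(`U x = U (P_σ x)`, `T x = T (P_σ x)`) and have weakly divergence-free range.  If `|⟪U x − T x, y⟫| ≤ η N(x) N(y)` for all weakly divergence-free
`x, y`, then it holds for all `x, y ∈ V2` (`η ≥ 0`, weights `w ≥ 0`). -/
theorem bilinear_of_divFree (S : Finset (Fin 3 → ℤ)) (w : (Fin 3 → ℤ) → ℝ) (η : ℝ) (hw0 : ∀ k, 0 ≤ w k) (hη : 0 ≤ η)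
    (U T : V2 →L[ℝ] V2)
    (hU : ∀ x : V2, U x = U ((Torus.divFreeL2 (Fin 3)).starProjection x))
    (hT : ∀ x : V2, T x = T ((Torus.divFreeL2 (Fin 3)).starProjection x))
    (hUr : ∀ x : V2, Torus.IsWeaklyDivFree (⇑(U x) : VF)) (hTr : ∀ x : V2, Torus.IsWeaklyDivFree (⇑(T x) : VF))
    (hbil : ∀ x y : V2, Torus.IsWeaklyDivFree (⇑x : VF) → Torus.IsWeaklyDivFree (⇑y : VF) → |⟪U x - T x, y⟫_ℝ| ≤ η
      * Real.sqrt (∑ k ∈ S, w k * ‖mFourierCoeff (EuclideanSpace.complexify ∘ ⇑x) k‖ ^ 2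
          + (‖x‖ ^ 2 - ∑ k ∈ S, ‖mFourierCoeff (EuclideanSpace.complexify ∘ ⇑x) k‖ ^ 2))
      * Real.sqrt (∑ k ∈ S, w k * ‖mFourierCoeff (EuclideanSpace.complexify ∘ ⇑y) k‖ ^ 2
          + (‖y‖ ^ 2 - ∑ k ∈ S, ‖mFourierCoeff (EuclideanSpace.complexify ∘ ⇑y) k‖ ^ 2))) :
    ∀ x y : V2, |⟪U x - T x, y⟫_ℝ| ≤ η
      * Real.sqrt (∑ k ∈ S, w k * ‖mFourierCoeff (EuclideanSpace.complexify ∘ ⇑x) k‖ ^ 2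
          + (‖x‖ ^ 2 - ∑ k ∈ S, ‖mFourierCoeff (EuclideanSpace.complexify ∘ ⇑x) k‖ ^ 2))
      * Real.sqrt (∑ k ∈ S, w k * ‖mFourierCoeff (EuclideanSpace.complexify ∘ ⇑y) k‖ ^ 2
          + (‖y‖ ^ 2 - ∑ k ∈ S, ‖mFourierCoeff (EuclideanSpace.complexify ∘ ⇑y) k‖ ^ 2)) := by
  intro x y
  set Px := (Torus.divFreeL2 (Fin 3)).starProjection x with hPx
  set Py := (Torus.divFreeL2 (Fin 3)).starProjection y with hPy
  -- reduce the pairing to the projected data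
  have hmem : U Px - T Px ∈ Torus.divFreeL2 (Fin 3) := by
    rw [Torus.mem_divFreeL2_iff]
    have e : (⇑(U Px - T Px) : VF) =ᵐ[volume] fun z => (U Px : VF) z - (T Px : VF) z := Lp.coeFn_sub _ _
    exact ((Torus.divFreeL2 (Fin 3)).sub_mem ((Torus.mem_divFreeL2_iff _).2 (hUr Px)) ((Torus.mem_divFreeL2_iff _).2 (hTr Px)))
  have horth : ⟪U Px - T Px, y - Py⟫_ℝ = 0 :=
    (Torus.divFreeL2 (Fin 3)).inner_right_of_mem_orthogonal hmem ((Torus.divFreeL2 (Fin 3)).sub_starProjection_mem_orthogonal y)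
  have e1 : ⟪U x - T x, y⟫_ℝ = ⟪U Px - T Px, Py⟫_ℝ := by
    rw [hU x, hT x, ← hPx]
    have ey : y = Py + (y - Py) := by abel
    conv_lhs => rw [ey]
    rw [inner_add_right, horth, add_zero]
  rw [e1]
  have hxd : Torus.IsWeaklyDivFree (⇑Px : VF) := (Torus.mem_divFreeL2_iff _).1 ((Torus.divFreeL2 (Fin 3)).starProjection_apply_mem x)
  have hyd : Torus.IsWeaklyDivFree (⇑Py : VF) := (Torus.mem_divFreeL2_iff _).1 ((Torus.divFreeL2 (Fin 3)).starProjection_apply_mem y)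
  refine (hbil Px Py hxd hyd).trans ?_
  have h1 := Real.sqrt_le_sqrt (nsq_starProjection_le S w hw0 x)
  have h2 := Real.sqrt_le_sqrt (nsq_starProjection_le S w hw0 y)
  rw [← hPx] at h1; rw [← hPy] at h2
  exact mul_le_mul (mul_le_mul_of_nonneg_left h1 hη) h2 (Real.sqrt_nonneg _) (mul_nonneg hη (Real.sqrt_nonneg _))

/-- **(BIL) on divergence-free data suffices for two PROPAGATOR window maps.**  For `Torus.IsPropagator` families `Um`, `Um1` on `[0,T₀]`
and any two times `a, b`, the window maps `U = Um1 a b`, `T = Um a b` see only `P_σ` of their argument and have divergence-free range, so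
(BIL) for weakly divergence-free `x, y` implies (BIL) for all `x, y ∈ V2`. -/
theorem bilinear_of_divFree_propagator (S : Finset (Fin 3 → ℤ)) (w : (Fin 3 → ℤ) → ℝ) (η : ℝ) (hw0 : ∀ k, 0 ≤ w k) (hη : 0 ≤ η)
    {T₀ : ℝ} {bm bm1 : ℝ → VF} {𝔸m 𝔸m1 : Torus.Visc4 (Fin 3)} {Um Um1 : ℝ → ℝ → (V2 →L[ℝ] V2)}
    (hUm : Torus.IsPropagator T₀ bm 𝔸m Um) (hUm1 : Torus.IsPropagator T₀ bm1 𝔸m1 Um1) (a b : ℝ)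
    (hbil : ∀ x y : V2, Torus.IsWeaklyDivFree (⇑x : VF) → Torus.IsWeaklyDivFree (⇑y : VF) → |⟪Um1 a b x - Um a b x, y⟫_ℝ| ≤ η
      * Real.sqrt (∑ k ∈ S, w k * ‖mFourierCoeff (EuclideanSpace.complexify ∘ ⇑x) k‖ ^ 2
          + (‖x‖ ^ 2 - ∑ k ∈ S, ‖mFourierCoeff (EuclideanSpace.complexify ∘ ⇑x) k‖ ^ 2))
      * Real.sqrt (∑ k ∈ S, w k * ‖mFourierCoeff (EuclideanSpace.complexify ∘ ⇑y) k‖ ^ 2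
          + (‖y‖ ^ 2 - ∑ k ∈ S, ‖mFourierCoeff (EuclideanSpace.complexify ∘ ⇑y) k‖ ^ 2))) :
    ∀ x y : V2, |⟪Um1 a b x - Um a b x, y⟫_ℝ| ≤ η
      * Real.sqrt (∑ k ∈ S, w k * ‖mFourierCoeff (EuclideanSpace.complexify ∘ ⇑x) k‖ ^ 2
          + (‖x‖ ^ 2 - ∑ k ∈ S, ‖mFourierCoeff (EuclideanSpace.complexify ∘ ⇑x) k‖ ^ 2))
      * Real.sqrt (∑ k ∈ S, w k * ‖mFourierCoeff (EuclideanSpace.complexify ∘ ⇑y) k‖ ^ 2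
          + (‖y‖ ^ 2 - ∑ k ∈ S, ‖mFourierCoeff (EuclideanSpace.complexify ∘ ⇑y) k‖ ^ 2)) :=
  bilinear_of_divFree S w η hw0 hη (Um1 a b) (Um a b)
    (fun x => hUm1.apply_eq_apply_starProjection a b x) (fun x => hUm.apply_eq_apply_starProjection a b x)
    (fun x => hUm1.divFree a b x) (fun x => hUm.divFree a b x) hbil

end Summit.AnomalousDissipation.AnomalousDissipation.Theorems.SolenoidalFractalHomogenisation.LagrangianStep

end
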